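import Summits.PneNP.PneNP.Theses.OneSlice
import Summits.PneNP.PneNP.Theorems.ConstantBand.Negative.LoadBearing
import Literature.Computability.Complexity.RossmanMonotoneClique
import Literature.Computability.Complexity.Rossman2008CliqueProofs

/-!
# `sharpness-sandwich` — SIDE RUNG of crux `OneSlice.ConstantBand` (stmt-PneNP-2834): the bounded-depth slice bound

Crux-plan seat `planner-cruxplan-stmt-PneNP-2834-sharpness-sandwich-0`, round 1, 2026-08-16.
Idea card `Cruxes/ConstantBand/Ideas/sharpness-sandwich.md` (ideator 3); triage r1: pass ×3 with the unanimous
sharpening "drop the Transfer `Fragility` (⟺ the crux by `TwoSliceCoupling`, costume); file the bounded-depth theorem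
(`SharpnessForcing` + a sharp-threshold charge) as a support / side theorem".

VERDICT of the crux-plan: **no concluding skeleton for `ConstantBand`** (see `Lines/sharpness-sandwich.md`): every
typeable composition `… → ConstantBand` from this idea needs a residual stub that is the crux up to threshold
decoration (`(A ∧ T_{≥ j⁻}) ∨ T_{≥ j⁺}` realises the forced band-pass profile of any band-accurate `A` at polynomial
cost), and the charging lever (total influence of shallow circuits is polylogarithmic) dies at unbounded depth, where
sharp thresholds cost `Õ(N)` monotone gates. THIS FILE is the salvage the panel asked for, typed and composed:

THE SIDE-RUNG THEOREM `ShallowSliceConc` = the SUPPORT ITEM `OneSlice.ShallowSliceBound` (stmt-PneNP-14083, rank 9 on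
route-PneNP-OneSlice, filed by this seat 2026-08-16T02:48Z with the inline signature of `Sketch.lean`, whose `Iff.rfl` read-back against
`ShallowSliceConc` is checked there, rc 0). MATERIALISATION STATUS: the ledger row exists but the route FILE has not been re-rendered with
the decl — every edit of route-PneNP-OneSlice currently bounces `route.target-unreachable` (pre-existing shape defect: no item concludes
`SliceTarget`; tenure-planner repair). Until then this file concludes `ShallowSliceConc` BY NAME (`ShallowSliceConc_of`) and the stubs are
registered on stmt-PneNP-14083 with `--crux-decl …SharpnessSandwich.ShallowSliceConc`; once `OneSlice.ShallowSliceBound` exists, append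
  `theorem shallowSliceBound_iff : Summit.PneNP.PneNP.Theses.OneSlice.ShallowSliceBound ↔ ShallowSliceConc := Iff.rfl`
  `theorem ShallowSliceBound_of … : Summit.PneNP.PneNP.Theses.OneSlice.ShallowSliceBound := shallowSliceBound_iff.2 (ShallowSliceConc_of hB hF hQ hS)`
and re-run `ledger skeleton check <this file> --crux stmt-PneNP-14083` (default decl). THE THEOREM — *no monotone unbounded-fan-in circuit of depth `≤ d` and size `≤ n^c` is
`δ`-accurate for `k`-CLIQUE on a central Hamming slice of the critical random graph* :
`∀ d c, ∃ k ≥ 3, ∃ δ > 0, ∀ᶠ n, ∀ j` central, `∀ D` over `{∧ₘ, ∨ₘ | m}` with `acDepth D ≤ d`,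
`#err_j(D, CLIQUE_k) ≤ δ · #slice_j → n^c < |D|`.
It is (i) the bounded-depth, unbounded-fan-in special case of the route target `SliceTarget` (hence of `ConstantBand`
at `w = 0`), (ii) literally the conclusion `CruxConc` of crux #4 `SliceACZero` restricted to MONOTONE circuits
(`shallowSliceConc_of_cruxConc`, proved below) — but reached WITHOUT #4's hypothesis (Rossman 2008 in fixed-δ
window-uniform form): the lower-bound engine is Rossman's Theorem 1, PROVED in the tree (`thm1_finite`,
`Rossman2010_cliqueVsSubcritical_holds`). New content as far as searched (Rossman2008 = constant depth WITH negations on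
`G(n,p)`; GMZ arXiv:2311.04204 Thm 1.4 needs `k = Θ(n)`; no slice/monotone/bounded-depth statement in print — grounder
g16-17, triage r1-2/r1-3).

FOUR STUBS (sorries live ONLY in `stub_*`; statements are the named `Prop`s `…Stmt`, restated verbatim by the stubs;
`Registered.stub_*` are the name-keyed aliases used as hypotheses of the composition, as in
`Cruxes/SliceACZero/Lines/russo-window-ladder.lean`):
* `stub_binarise` (S/M, routine) — an `{∧ₘ, ∨ₘ}`-circuit of size `s` on `N` inputs has an `{∧₂, ∨₂, 0, 1}`-circuit
  computing the same function with `≤ (s+1)(s+N+1)` gates (deduplicate arguments, chain binary gates, constants for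
  arity `0`).
* `stub_forcingUp` (L, THE HEART = the card's `SharpnessForcing`, triage-sharpened window) — for `k ≥ 5`, `4c < k`,
  `η > 0` there are `θ, δ > 0` with: eventually in `n`, for every central `j` and every `{∧₂,∨₂,0,1}`-circuit `C` of
  size `≤ n^c` with `#err_j(C) ≤ δ·#slice_j`, `C` accepts at least `(1-η)` of EVERY slice `t` with
  `j + j^{1-θ} ≤ t ≤ C(n,2)`. Proof plan: Cauchy–Schwarz planted acceptance on the slice
  (`E_j[ω_k²]/E_j[ω_k]² → 1 + k!`, triage tables j010586/j010621) ⇒ `Pr_{H,A}[C(H ∪ K_A)=1] ≥ 1 − √((k!+2)δ) − o(1)`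
  with `H` uniform on slice `j − C(k,2)` UNCONDITIONED; Markov ⇒ most `H` good; `Circuit.exists_restrict_sup` gives
  `C^H` (size `+1`); `thm1_finite` (`k ≥ 5`, `δ₁ ≤ k⁻³`, `η_thm = 1/2`, `c₀ = 2`, `eventually_largeN`) ⇒
  `Pr[C(H ∪ G(n,p^{1+δ₁})) = 1] ≥ 1 − e^{−n^{c'}}`; `H ∪ G⁻` is `Sym(E(K_n))`-invariant hence uniform on its slice
  given its size; Chebyshev puts `|H ∪ G⁻|` below `j + j^{1−θ}` for `θ < 2δ₁/(k−1)·(log n/log j) ≍ δ₁/(k−1)`; local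
  LYM (`t ↦ a_t(C)` non-decreasing for monotone `C`) finishes. All ingredients in the tree.
* `stub_cliqueScarcity` (S/M) — on central slices `Pr_j[CLIQUE_k] ≤ 2/k!` eventually (first moment:
  `C(n,k)·(j/N)^{C(k,2)} → 1/k!`; the Disproof's `card_slice_filter_supset_mul_le` / `choose_mul_θ_pow_le` pattern).
* `stub_shallowNotSharp` (M/L; the charge, CLIQUE-free, on ANY finite cube) — for `d, c, θ > 0` there is `j₀` with:
  for `j₀ ≤ j ≤ t ≤ j + j^{1−θ}`, `2t ≤ N`, every `acBasis` circuit of `acDepth ≤ d` and `≤ j^c` gates has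
  `|a_t − a_j| ≤ 1/4`. = Gamarnik–Mossel–Zadik Thm 2.2 (arXiv:2311.04204) in slice form; proof plan: slice/product
  coupling at `q = j/N` and `q' = t/N` (`SliceCouplingStmt` + `BinomialHazardStmt` of russo-window-ladder, rate
  `polylog/√j`), Russo–Margulis `|d/dq E_q f| ≤ I_q(f)` and `q·I_q(C) ≤ K_d polylog(|C|)` (`AndCoinStmt` + `BoppanaStmt`
  = Boppana 1997 / Tal 2017, russo-window-ladder's proved `biased_le`), integrated over `log(q'/q) ≤ j^{−θ}`.
  SHARED WORK: three of the four russo-window-ladder stubs (S1, S3, S4) are exactly what this stub consumes.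

COMPOSITION (kernel-checked, no sorry outside the stubs): `ShallowSliceConc_of`. Given `(d, c)`: binarised exponent
`c₂ = 2c + 5`, `k = 4c₂ + 5 = 8c + 25`, `η = 1/4`; `(θ₀, δ_F)` from forcing, `θ = min θ₀ 1/2`, `j₀` from the charge at
`(d, 2c, θ/2)`, `δ = min δ_F 1/8`; for large `n`, central `j` (`window_eventually`: `j ≥ j₀`, `n ≤ 5j`, `4j ≤ C(n,2)`),
a shallow `D` of size `≤ n^c` accurate on slice `j` binarises to `C` of size `≤ n^{c₂}` (`binSize_le`), forcing gives
`a_t(D) ≥ 3/4` at `t = ⌈j + j^{1−θ}⌉ ≤ min(2j, j + j^{1−θ/2})` (`window_arith`), scarcity + accuracy give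
`a_j(D) ≤ 2/k! + 1/8 ≤ 1/60 + 1/8`, and the charge gives `a_t(D) − a_j(D) ≤ 1/4`: contradiction, so `n^c < |D|`.

DISPROOF USED (`Cruxes/ConstantBand/Disproof.lean` gen 1 c1–2 + landed `Theorems/ConstantBand/Negative/LoadBearing.lean`,
IMPORTED here; vocabulary `thr`, `Central`, `Edge` is the disprover's): `constantBand_false_without_basis` — the side
rung keeps a basis (`monotoneACBasis`) AND a depth bound; a single `∧ₘ/∨ₘ` gate is a term/clause, killed by forcing
like any shallow circuit, and the one-gate CLIQUE of `exists_oneGate_cliqueFn` is not over `{∧ₘ,∨ₘ}`;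
`constantBand_false_without_central` — centrality is consumed twice (`window_eventually`; `stub_cliqueScarcity` and the
`E_j ≤ 1/4` side of forcing are false off the window); `le_of_bandLB` (`c ≤ k+2`) — here `k = 8c+25`;
`delta_le_of_bandLB` (`δ ≤ (2w+1)/k!`) — `δ ≤ δ_F(k) ≪ η²/k!` by construction; §5 `band_pseudoComplement` — not
engaged (one slice, no pseudo-complements used); tightness: `Rossman2010_upperBound` (constant-depth monotone circuits of
size `n^{k/4+O(1)}` ARE slice-accurate) is consistent because forcing needs `|C| ≤ n^{c₂}`, `c₂ < k/4`.
`ledger negatives --problem PneNP`: no clique/slice/threshold entry.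
-/

set_option linter.unusedVariables false
set_option linter.dupNamespace false
set_option linter.unusedSectionVars false

noncomputable section

namespace Summit.PneNP.PneNP.Cruxes.ConstantBand.SharpnessSandwich

open scoped BigOperators
open Finset Filter Literature.Computability.Complexity
open Summit.PneNP.PneNP.Theses.OneSlice (ConstantBand SliceTarget SliceACZero)
open Summit.PneNP.PneNP.Theorems.ConstantBand.Negative (Edge thr Central)

/-! ### Vocabulary -/

section Cube

variable {ι : Type} [Fintype ι] [DecidableEq ι]

/-- `|x|`: the number of ones of `x` (on edge vectors this is `edgeCount`, definitionally). [folklore] -/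
def wt (x : ι → Bool) : ℕ := #(univ.filter fun i => x i = true)

/-- `a_ℓ(f)`: the fraction of the Hamming slice `{|x| = ℓ}` on which `f = 1` (count / count; `0` on an empty
slice). Same definition as in `Cruxes/SliceACZero/Lines/russo-window-ladder.lean`. [folklore] -/
def sliceAvg (f : (ι → Bool) → Bool) (ℓ : ℕ) : ℝ :=
  (#(univ.filter fun x : ι → Bool => wt x = ℓ ∧ f x = true) : ℝ) /
    (#(univ.filter fun x : ι → Bool => wt x = ℓ) : ℝ)

end Cube

/-- `#slice_i`: the number of `n`-vertex graphs with exactly `i` edges (`= C(C(n,2), i)`). [folklore] -/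
def sliceCard (n i : ℕ) : ℕ := #(univ.filter fun x : Edge n → Bool => edgeCount x = i)

/-- `#{x : e(x) = i, f x = 1}`: acceptance count of `f` on slice `i`. [folklore] -/
def accCount (n i : ℕ) (f : (Edge n → Bool) → Bool) : ℕ :=
  #(univ.filter fun x : Edge n → Bool => edgeCount x = i ∧ f x = true)

/-- `#err_i(f) = #{x : e(x) = i, f x ≠ CLIQUE_k x}`: error count of `f` against `k`-CLIQUE on slice `i`
(the crux's inline error set; `cliqueFn` IS the route's inline clique function, `constantBand_iff`). [folklore] -/
def errCount (n k i : ℕ) (f : (Edge n → Bool) → Bool) : ℕ :=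
  #(univ.filter fun x : Edge n → Bool => edgeCount x = i ∧ f x ≠ cliqueFn n k x)

/-! ### The four stub STATEMENTS and the side-rung theorem -/

/-- Statement of `stub_binarise`: unbounded fan-in monotone circuits binarise at quadratic cost. [folklore] -/
def BinariseStmt : Prop :=
  ∀ (ι : Type) [Fintype ι] [DecidableEq ι] (D : Circuit ι), D.IsOver monotoneACBasis →
    ∃ C : Circuit ι, C.IsOver monotoneBasis01 ∧ C.eval = D.eval ∧
      C.size ≤ (D.size + 1) * (D.size + Fintype.card ι + 1)

/-- Statement of `stub_forcingUp` (the card's `SharpnessForcing`, window `j + j^{1-θ}`): a small fan-in-2 monotone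
circuit that is `δ`-accurate for `k`-CLIQUE on ONE central slice `j` accepts `≥ 1 - η` of every slice
`t ∈ [j + j^{1-θ}, C(n,2)]`. [cite: Rossman2010, Thm 1 (p. 4); this consequence is new] -/
def ForcingUpStmt : Prop :=
  ∀ k : ℕ, 5 ≤ k → ∀ c : ℕ, 4 * c < k → ∀ η : ℝ, 0 < η →
    ∃ θ : ℝ, 0 < θ ∧ ∃ δ : ℝ, 0 < δ ∧ ∀ᶠ n : ℕ in atTop, ∀ j : ℕ, Central k n j →
      ∀ C : Circuit (Edge n), C.IsOver monotoneBasis01 → C.size ≤ n ^ c →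
        (errCount n k j C.eval : ℝ) ≤ δ * sliceCard n j →
        ∀ t : ℕ, (j : ℝ) + (j : ℝ) ^ (1 - θ) ≤ t → t ≤ n.choose 2 →
          (1 - η) * (sliceCard n t : ℝ) ≤ accCount n t C.eval

/-- Statement of `stub_cliqueScarcity`: on central slices at most a `2/k!` fraction of the graphs contain a
`k`-clique (`k ≥ 5`, eventually in `n`, uniformly in the window). [folklore] -/
def CliqueScarcityStmt : Prop :=
  ∀ k : ℕ, 5 ≤ k → ∀ᶠ n : ℕ in atTop, ∀ j : ℕ, Central k n j →
    (accCount n j (cliqueFn n k) : ℝ) ≤ 2 / (k.factorial : ℝ) * sliceCard n j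

/-- Statement of `stub_shallowNotSharp` (Gamarnik–Mossel–Zadik Thm 2.2 in slice form, on any finite cube): a
bounded-depth, polynomial-size `acBasis` circuit cannot change its slice-acceptance by more than `1/4` inside the
multiplicative window `[j, j + j^{1-θ}]`. [cite: GamarnikMosselZadik2023 = arXiv:2311.04204, Thm 2.2; Boppana1997] -/
def ShallowNotSharpStmt : Prop :=
  ∀ (d c : ℕ) (θ : ℝ), 0 < θ → ∃ j₀ : ℕ, ∀ (ι : Type) [Fintype ι] [DecidableEq ι] (j t : ℕ),
    j₀ ≤ j → j ≤ t → (t : ℝ) ≤ j + (j : ℝ) ^ (1 - θ) → 2 * t ≤ Fintype.card ι →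
      ∀ D : Circuit ι, D.IsOver acBasis → D.acDepth ≤ d → D.size ≤ j ^ c →
        |sliceAvg D.eval t - sliceAvg D.eval j| ≤ 1 / 4

/-- **The side-rung theorem** (bounded-depth, unbounded-fan-in monotone slice lower bound; the monotone case of
crux #4's conclusion, reached without its hypothesis): for every depth `d` and exponent `c` there are `k ≥ 3` and
`δ > 0` such that, eventually in `n`, for every central `j`, every `{∧ₘ,∨ₘ}`-circuit of `acDepth ≤ d` that errs on at
most `δ·#slice_j` graphs of the slice `j` has more than `n^c` gates. Written in the disprover's vocabulary
(`Central`, `thr`) so that the route-item form is an `Iff.rfl` read-back. [folklore] -/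
def ShallowSliceConc : Prop :=
  ∀ d c : ℕ, ∃ k : ℕ, 3 ≤ k ∧ ∃ δ : ℝ, 0 < δ ∧ ∀ᶠ n : ℕ in atTop, ∀ j : ℕ, Central k n j →
    ∀ D : Circuit (Edge n), D.IsOver monotoneACBasis → D.acDepth ≤ d →
      (errCount n k j D.eval : ℝ) ≤ δ * sliceCard n j → n ^ c < D.size

/-- The conclusion `Conc` of crux #4 `SliceACZero` (verbatim the read-back `CruxConc` of
`Cruxes/SliceACZero/Lines/russo-window-ladder.lean`, in this file's vocabulary): the same bound for all `acBasis`
circuits (negations allowed). [folklore] -/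
def CruxConc4 : Prop :=
  ∀ d c : ℕ, ∃ k : ℕ, 3 ≤ k ∧ ∃ δ : ℝ, 0 < δ ∧ ∀ᶠ n : ℕ in atTop, ∀ j : ℕ, Central k n j →
    ∀ D : Circuit (Edge n), D.IsOver acBasis → D.acDepth ≤ d →
      (errCount n k j D.eval : ℝ) ≤ δ * sliceCard n j → n ^ c < D.size

/-- **Placement in the route's lattice**: crux #4's conclusion implies the side rung (monotone unbounded fan-in
gates are `acBasis` gates). The point of the side rung is that it is provable WITHOUT #4's hypothesis. [folklore] -/
theorem shallowSliceConc_of_cruxConc4 (h : CruxConc4) : ShallowSliceConc := by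
  intro d c
  obtain ⟨k, hk, δ, hδ, hev⟩ := h d c
  refine ⟨k, hk, δ, hδ, ?_⟩
  filter_upwards [hev] with n hn j hj D hD hdep herr
  exact hn j hj D (hD.mono monotoneACBasis_subset_acBasis) hdep herr

/-! ### The four registered stubs (`sorry` lives ONLY in these four theorems) -/

/-- **Stub 1 — binarisation (S/M, routine).** Every `{∧ₘ, ∨ₘ | m}`-circuit `D` on a finite input type has an
`{∧₂, ∨₂, 0, 1}`-circuit computing `D.eval` with at most `(|D|+1)(|D|+N+1)` gates. Proof plan: per gate, deduplicate
its `≤ |D| + N` distinct argument wires and replace `∧ₘ`/`∨ₘ` by a chain of binary gates (arity `0`: a constant gate;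
arity `1`: `w ∧ w`); re-index back-references (`Circuit.mapGates`-style bookkeeping as in `GateElimination.binarize`,
but size-changing). [folklore] -/
theorem stub_binarise :
    ∀ (ι : Type) [Fintype ι] [DecidableEq ι] (D : Circuit ι), D.IsOver monotoneACBasis →
      ∃ C : Circuit ι, C.IsOver monotoneBasis01 ∧ C.eval = D.eval ∧
        C.size ≤ (D.size + 1) * (D.size + Fintype.card ι + 1) := by
  sorry

/-- **Stub 2 — forcing up (L, THE HEART; the card's `SharpnessForcing` with the triage-sharpened window).**
For `k ≥ 5`, `4c < k`, `η > 0` there are `θ > 0`, `δ > 0` such that eventually in `n`: for every central `j` and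
every `{∧₂,∨₂,0,1}`-circuit `C` with `|C| ≤ n^c` and `#err_j(C) ≤ δ·#slice_j`, every slice `t` with
`j + j^{1-θ} ≤ t ≤ C(n,2)` has `#acc_t(C) ≥ (1-η)·#slice_t`. Proof plan (all ingredients in the tree): (1) planted
acceptance by Cauchy–Schwarz on slice `j` with `H` uniform on slice `j − C(k,2)` (law of `H ∪ K_A` given
`H ∩ K_A = ∅` has density `ω_k/E_j ω_k`; `E_j[ω_k²]/E_j[ω_k]² → 1 + k!`; `P[H ∩ K_A ≠ ∅] ≤ C(k,2)·j/C(n,2) → 0`):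
`Pr_{H,A}[C(H ∪ K_A) = 0] ≤ √((k!+2)δ) + o(1)`; (2) Markov: all but `2√((k!+2)δ) + o(1)` of the `H` have
`Pr_A[C^H(K_A) = 1] ≥ 1/2`, `C^H = C(H ∨ ·)` over `{∧₂,∨₂,0,1}` of size `≤ n^c + 1 ≤ 2n^{k/4}`
(`Circuit.exists_restrict_sup`); (3) `thm1_finite` at `(k, δ₁ = k⁻³, c₀ = 2, η_thm = 1/2)` with `eventually_largeN`:
`Pr[C(H ∨ G(n, p^{1+δ₁})) = 1] ≥ 1 − exp(−n^{c'})` for good `H`; (4) `H ∨ G⁻` is invariant under `Sym(E(K_n))`, hence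
uniform on slice `t` given `|H ∨ G⁻| = t`, so `Σ_t P[|H ∨ G⁻| = t]·a_t(C) ≥ 1 − 2√((k!+2)δ) − o(1)`; (5) Chebyshev:
`|H ∨ G⁻| ≤ j + j^{1−θ}` with probability `1 − o(1)` for `θ = δ₁/(k−1)` (mean `≤ j − C(k,2) + (m_k+1)·n^{−2δ₁/(k−1)}`,
variance `≤ m_k`, and `j^{1−θ} ≥ (m_k/2)^{1−θ} ≫ m_k n^{−2δ₁/(k−1)}`); (6) `t ↦ a_t(C)` is non-decreasing (local LYM,
`Finset.local_lubell_yamamoto_meshalkin_inequality_div`, `Circuit.monotone_eval_of_isOver_monotoneBasis`), so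
`a_t(C) ≥ 1 − η` for all `t ≥ j + j^{1−θ}` once `δ ≤ η²/(64(k!+2))` and `n` is large. Honours the Disproof: uses
centrality (`t`-window above `j`, `j → ∞`), the basis (Thm 1 is a closure argument on `{∧₂,∨₂}`), `c < k/4` is sharp by
`Rossman2010_upperBound`. [cite: Rossman2010, Thm 1 (p. 4), §7 (p. 10); this consequence is new] -/
theorem stub_forcingUp :
    ∀ k : ℕ, 5 ≤ k → ∀ c : ℕ, 4 * c < k → ∀ η : ℝ, 0 < η →
      ∃ θ : ℝ, 0 < θ ∧ ∃ δ : ℝ, 0 < δ ∧ ∀ᶠ n : ℕ in atTop, ∀ j : ℕ, Central k n j →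
        ∀ C : Circuit (Edge n), C.IsOver monotoneBasis01 → C.size ≤ n ^ c →
          (errCount n k j C.eval : ℝ) ≤ δ * sliceCard n j →
          ∀ t : ℕ, (j : ℝ) + (j : ℝ) ^ (1 - θ) ≤ t → t ≤ n.choose 2 →
            (1 - η) * (sliceCard n t : ℝ) ≤ accCount n t C.eval := by
  sorry

/-- **Stub 3 — clique scarcity on central slices (S/M).** For `k ≥ 5`, eventually in `n`, on every central slice
`j` at most `2/k!` of the graphs contain a `k`-clique. Proof plan: union bound `#acc_j(CLIQUE_k) ≤ C(n,k)·#{x : e(x)=j,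
K_A ⊆ x}`, hypergeometric tail `#{x : e(x) = j, F ⊆ x} ≤ (j/C(n,2))^{|F|}·#slice_j` (the Disproof's
`card_slice_filter_supset_mul_le`), `j ≤ m_k + m_k^{3/4}`, `C(n,k)·(m_k(1+m_k^{-1/4})/C(n,2))^{C(k,2)} ≤
(1+m_k^{-1/4})^{C(k,2)}/k! → 1/k!` (`choose_mul_θ_pow_le`). [folklore] -/
theorem stub_cliqueScarcity :
    ∀ k : ℕ, 5 ≤ k → ∀ᶠ n : ℕ in atTop, ∀ j : ℕ, Central k n j →
      (accCount n j (cliqueFn n k) : ℝ) ≤ 2 / (k.factorial : ℝ) * sliceCard n j := by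
  sorry

/-- **Stub 4 — shallow circuits are not sharp on slices (M/L; GMZ Thm 2.2 in slice clothing, CLIQUE-free).**
For `d, c` and `θ > 0` there is `j₀` such that on ANY finite cube `{0,1}^ι` (`N = |ι|`): for `j₀ ≤ j ≤ t ≤ j + j^{1−θ}`
with `2t ≤ N`, every `acBasis` circuit `D` of `acDepth ≤ d` and `≤ j^c` gates has `|a_t(D) − a_j(D)| ≤ 1/4`.
Proof plan: `|a_j(D) − E_{j/N} D| + |a_t(D) − E_{t/N} D| ≤ 2K₀K(log(j^c+3))^B/√j` (slice coupling + binomial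
hazard + AND-coin + Boppana: stubs S1–S4 of `Cruxes/SliceACZero/Lines/russo-window-ladder.lean`, its proved
`hybrid_le`/`biased_le`); Russo–Margulis `|d/dq E_q D| ≤ I_q(D)` (unsigned biased influence `biasedInfluence`) and
`q·I_q(D) ≤ (K/2)(log(|D|+3))^B` for `2q ≤ 1` give `|E_{t/N} D − E_{j/N} D| ≤ (K/2)(log(j^c+3))^B·log(t/j) ≤
(K/2)(c log j + 2)^B·j^{−θ}`; both `→ 0`, so `≤ 1/4` for `j ≥ j₀(d,c,θ)`, uniformly in the cube.
[cite: GamarnikMosselZadik2023, Thm 2.2; Boppana1997; Tal2017, Thm 3.6] -/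
theorem stub_shallowNotSharp :
    ∀ (d c : ℕ) (θ : ℝ), 0 < θ → ∃ j₀ : ℕ, ∀ (ι : Type) [Fintype ι] [DecidableEq ι] (j t : ℕ),
      j₀ ≤ j → j ≤ t → (t : ℝ) ≤ j + (j : ℝ) ^ (1 - θ) → 2 * t ≤ Fintype.card ι →
        ∀ D : Circuit ι, D.IsOver acBasis → D.acDepth ≤ d → D.size ≤ j ^ c →
          |sliceAvg D.eval t - sliceAvg D.eval j| ≤ 1 / 4 := by
  sorry

/-! ### Name-keyed aliases of the four statements (the hypotheses of the composition) -/
namespace Registered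

/-- Alias of `BinariseStmt` keyed by the registered stub name. [folklore] -/
abbrev stub_binarise : Prop := BinariseStmt
/-- Alias of `ForcingUpStmt` keyed by the registered stub name. [folklore] -/
abbrev stub_forcingUp : Prop := ForcingUpStmt
/-- Alias of `CliqueScarcityStmt` keyed by the registered stub name. [folklore] -/
abbrev stub_cliqueScarcity : Prop := CliqueScarcityStmt
/-- Alias of `ShallowNotSharpStmt` keyed by the registered stub name. [folklore] -/
abbrev stub_shallowNotSharp : Prop := ShallowNotSharpStmt

end Registered

/-! ### Proved glue: counting on the edge cube -/

/-- `|E(K_n)| = C(n,2)`. [folklore] -/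
theorem card_edge (n : ℕ) : Fintype.card (Edge n) = n.choose 2 := card_edgeSet_top_fin n

/-- On edge vectors the general-cube slice average is `#acc / #slice` (`wt = edgeCount` definitionally). [folklore] -/
theorem sliceAvg_edge {n : ℕ} (f : (Edge n → Bool) → Bool) (t : ℕ) :
    sliceAvg f t = (accCount n t f : ℝ) / (sliceCard n t : ℝ) := rfl

/-- Slices `t ≤ C(n,2)` are non-empty. [folklore] -/
theorem sliceCard_pos {n t : ℕ} (ht : t ≤ n.choose 2) : 0 < sliceCard n t := by
  classical
  have hcard : t ≤ (univ : Finset (Edge n)).card := by rw [card_univ, card_edge]; exact ht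
  obtain ⟨s, -, hs⟩ := Finset.exists_subset_card_eq hcard
  unfold sliceCard
  refine Finset.card_pos.2 ⟨fun e => decide (e ∈ s), ?_⟩
  rw [mem_filter]
  refine ⟨mem_univ _, ?_⟩
  have hx : (univ.filter fun e : Edge n => decide (e ∈ s) = true) = s := by
    ext e; simp
  unfold edgeCount
  rw [← hs]
  convert congrArg Finset.card hx using 2

/-- Accepted points are either accepted by `CLIQUE_k` or errors: `#acc_i(f) ≤ #acc_i(CLIQUE_k) + #err_i(f)`. [folklore] -/
theorem accCount_le_clique_add_err {n : ℕ} (k i : ℕ) (f : (Edge n → Bool) → Bool) :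
    accCount n i f ≤ accCount n i (cliqueFn n k) + errCount n k i f := by
  classical
  unfold accCount errCount
  refine (card_le_card ?_).trans (card_union_le _ _)
  intro x hx
  rw [mem_filter] at hx
  rw [mem_union, mem_filter, mem_filter]
  by_cases hq : cliqueFn n k x = true
  · exact Or.inl ⟨mem_univ _, hx.2.1, hq⟩
  · refine Or.inr ⟨mem_univ _, hx.2.1, ?_⟩
    rw [hx.2.2]
    exact fun h => hq h.symm

/-- `#acc_i(f) ≤ #slice_i`. [folklore] -/
theorem accCount_le_sliceCard {n : ℕ} (i : ℕ) (f : (Edge n → Bool) → Bool) :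
    accCount n i f ≤ sliceCard n i := by
  classical
  unfold accCount sliceCard
  exact card_le_card fun x hx => by
    rw [mem_filter] at hx ⊢
    exact ⟨hx.1, hx.2.1⟩

/-! ### Proved glue: arithmetic -/

/-- Size of the binarised circuit: `(s+1)(s + C(n,2) + 1) ≤ n^{2c+5}` for `s ≤ n^c`, `n ≥ 2`. [folklore] -/
theorem binSize_le {n c s : ℕ} (hn : 2 ≤ n) (hs : s ≤ n ^ c) :
    (s + 1) * (s + n.choose 2 + 1) ≤ n ^ (2 * c + 5) := by
  have hn1 : 1 ≤ n := by omega
  have hN : n.choose 2 ≤ n ^ 2 := Nat.choose_le_pow n 2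
  have hc0 : 1 ≤ n ^ c := Nat.one_le_pow _ _ hn1
  have h1 : s + 1 ≤ n ^ (c + 1) := by
    calc s + 1 ≤ n ^ c + n ^ c := by omega
      _ = 2 * n ^ c := by ring
      _ ≤ n * n ^ c := Nat.mul_le_mul_right _ hn
      _ = n ^ (c + 1) := by ring
  have hc2 : n ^ c ≤ n ^ (c + 2) := Nat.pow_le_pow_right hn1 (by omega)
  have h22 : n ^ 2 ≤ n ^ (c + 2) := Nat.pow_le_pow_right hn1 (by omega)
  have h02 : 1 ≤ n ^ (c + 2) := Nat.one_le_pow _ _ hn1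
  have h4 : 4 ≤ n ^ 2 := by
    have := Nat.pow_le_pow_left hn 2
    simpa using this
  have h2 : s + n.choose 2 + 1 ≤ n ^ (c + 4) := by
    calc s + n.choose 2 + 1 ≤ n ^ (c + 2) + n ^ (c + 2) + n ^ (c + 2) + n ^ (c + 2) := by omega
      _ = 4 * n ^ (c + 2) := by ring
      _ ≤ n ^ 2 * n ^ (c + 2) := Nat.mul_le_mul_right _ h4
      _ = n ^ (c + 4) := by ring
  calc (s + 1) * (s + n.choose 2 + 1) ≤ n ^ (c + 1) * n ^ (c + 4) := Nat.mul_le_mul h1 h2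
    _ = n ^ (2 * c + 5) := by ring

/-- Window arithmetic from `2 ≤ j^{θ/2}` (`0 < θ ≤ 1`, `j ≥ 1`): `j^{1-θ} + 1 ≤ j` and
`j^{1-θ} + 1 ≤ j^{1-θ/2}`. [folklore] -/
theorem window_arith {j : ℕ} {θ : ℝ} (hθ0 : 0 < θ) (hθ1 : θ ≤ 1) (hj1 : (1 : ℝ) ≤ j)
    (h2 : 2 ≤ (j : ℝ) ^ (θ / 2)) :
    (j : ℝ) ^ (1 - θ) + 1 ≤ j ∧ (j : ℝ) ^ (1 - θ) + 1 ≤ (j : ℝ) ^ (1 - θ / 2) := by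
  have hjpos : (0 : ℝ) < j := by linarith
  set a : ℝ := (j : ℝ) ^ (1 - θ) with ha
  have ha1 : 1 ≤ a := Real.one_le_rpow hj1 (by linarith)
  have ha0 : 0 ≤ a := by linarith
  have hhalf0 : 0 ≤ (j : ℝ) ^ (θ / 2) := Real.rpow_nonneg hjpos.le _
  have hθj : 4 ≤ (j : ℝ) ^ θ := by
    have : (j : ℝ) ^ θ = (j : ℝ) ^ (θ / 2) * (j : ℝ) ^ (θ / 2) := by
      rw [← Real.rpow_add hjpos]; ring_nf
    rw [this]; nlinarith
  have hprod1 : a * (j : ℝ) ^ θ = j := by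
    rw [ha, ← Real.rpow_add hjpos]
    simp
  have hprod2 : a * (j : ℝ) ^ (θ / 2) = (j : ℝ) ^ (1 - θ / 2) := by
    rw [ha, ← Real.rpow_add hjpos]; ring_nf
  constructor
  · calc a + 1 ≤ a * 4 := by linarith
      _ ≤ a * (j : ℝ) ^ θ := mul_le_mul_of_nonneg_left hθj ha0
      _ = j := hprod1
  · calc a + 1 ≤ a * 2 := by linarith
      _ ≤ a * (j : ℝ) ^ (θ / 2) := mul_le_mul_of_nonneg_left h2 ha0
      _ = (j : ℝ) ^ (1 - θ / 2) := hprod2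

/-- `M^{3/4} ≤ M/2` for `M ≥ 16` (as in russo-window-ladder). [folklore] -/
theorem rpow_three_quarters_le_half {M : ℝ} (hM : 16 ≤ M) : M ^ ((3 : ℝ) / 4) ≤ M / 2 := by
  have hM0 : 0 < M := by linarith
  have h1 : M ^ ((3 : ℝ) / 4) = M * M ^ (-(1 : ℝ) / 4) := by
    rw [show (3 : ℝ) / 4 = 1 + -(1 : ℝ) / 4 by norm_num, Real.rpow_add hM0, Real.rpow_one]
  have h2 : M ^ (-(1 : ℝ) / 4) ≤ (16 : ℝ) ^ (-(1 : ℝ) / 4) :=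
    Real.rpow_le_rpow_of_nonpos (by norm_num) hM (by norm_num)
  have h3 : (16 : ℝ) ^ (-(1 : ℝ) / 4) = 1 / 2 := by
    have h16 : (16 : ℝ) = (2 : ℝ) ^ (4 : ℝ) := by
      rw [show (4 : ℝ) = ((4 : ℕ) : ℝ) by norm_num, Real.rpow_natCast]; norm_num
    rw [h16, ← Real.rpow_mul (by norm_num : (0 : ℝ) ≤ 2),
      show (4 : ℝ) * (-(1 : ℝ) / 4) = -1 by norm_num, Real.rpow_neg_one]
    norm_num
  rw [h1]
  calc M * M ^ (-(1 : ℝ) / 4) ≤ M * (1 / 2) := by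
        rw [← h3]; exact mul_le_mul_of_nonneg_left h2 hM0.le
    _ = M / 2 := by ring

/-- **Window arithmetic** (where `3 ≤ k` and the centrality clause — load-bearing by the Disproof's
`constantBand_false_without_central` — are consumed): eventually in `n`, every central `j` satisfies `j₀ ≤ j`,
`n ≤ 5j` and `4j ≤ C(n,2)`. Proof as in russo-window-ladder's `window_eventually`, with `n^{-2/(k-1)} < 1/8`
eventually: `m_k ≥ (n−3)/2`, `m_k^{3/4} ≤ m_k/2`, `m_k ≤ C(n,2)/8`. [folklore] -/
theorem window_eventually {k : ℕ} (hk : 3 ≤ k) (j₀ : ℕ) :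
    ∀ᶠ n : ℕ in atTop, ∀ j : ℕ, Central k n j → j₀ ≤ j ∧ n ≤ 5 * j ∧ 4 * j ≤ n.choose 2 := by
  have hk1 : (2 : ℝ) ≤ (k : ℝ) - 1 := by
    have : (3 : ℝ) ≤ k := by exact_mod_cast hk
    linarith
  have hαpos : 0 < (2 : ℝ) / ((k : ℝ) - 1) := div_pos two_pos (by linarith)
  have hα1 : (2 : ℝ) / ((k : ℝ) - 1) ≤ 1 := by rw [div_le_one (by linarith)]; exact hk1
  have hr : Tendsto (fun n : ℕ => (n : ℝ) ^ (-(2 : ℝ) / ((k : ℝ) - 1))) atTop (nhds 0) := by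
    have := (tendsto_rpow_neg_atTop hαpos).comp tendsto_natCast_atTop_atTop
    refine this.congr fun n => ?_
    rw [Function.comp_apply, neg_div]
  filter_upwards [hr.eventually (gt_mem_nhds (by norm_num : (0 : ℝ) < 1 / 8)),
    eventually_ge_atTop (max 35 (4 * j₀ + 3))] with n hn8 hn j hj
  have hn35 : 35 ≤ n := (le_max_left _ _).trans hn
  have hnj₀ : 4 * j₀ + 3 ≤ n := (le_max_right _ _).trans hn
  have hnR : (35 : ℝ) ≤ n := by exact_mod_cast hn35
  have hnpos : (0 : ℝ) < n := by linarith
  have hr0 : 0 ≤ (n : ℝ) ^ (-(2 : ℝ) / ((k : ℝ) - 1)) := Real.rpow_nonneg hnpos.le _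
  have hN : ((n.choose 2 : ℕ) : ℝ) = n * (n - 1) / 2 := Nat.cast_choose_two (K := ℝ) n
  have hNr0 : 0 ≤ ((n.choose 2 : ℕ) : ℝ) * (n : ℝ) ^ (-(2 : ℝ) / ((k : ℝ) - 1)) :=
    mul_nonneg (Nat.cast_nonneg _) hr0
  have hm_le : (thr k n : ℝ) ≤ ((n.choose 2 : ℕ) : ℝ) * (n : ℝ) ^ (-(2 : ℝ) / ((k : ℝ) - 1)) :=
    Nat.floor_le hNr0
  have hm_ge : ((n.choose 2 : ℕ) : ℝ) * (n : ℝ) ^ (-(2 : ℝ) / ((k : ℝ) - 1)) - 1 < (thr k n : ℝ) :=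
    Nat.sub_one_lt_floor _
  have hr_ge : (n : ℝ) ^ (-(1 : ℝ)) ≤ (n : ℝ) ^ (-(2 : ℝ) / ((k : ℝ) - 1)) := by
    refine Real.rpow_le_rpow_of_exponent_le (by linarith) ?_
    rw [neg_div, neg_le_neg_iff]; exact hα1
  have hNr_ge : ((n : ℝ) - 1) / 2 ≤ ((n.choose 2 : ℕ) : ℝ) * (n : ℝ) ^ (-(2 : ℝ) / ((k : ℝ) - 1)) := by
    calc ((n : ℝ) - 1) / 2 = ((n.choose 2 : ℕ) : ℝ) * (n : ℝ) ^ (-(1 : ℝ)) := by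
          rw [hN, Real.rpow_neg_one]; field_simp
      _ ≤ _ := mul_le_mul_of_nonneg_left hr_ge (Nat.cast_nonneg _)
  have hNr_le : ((n.choose 2 : ℕ) : ℝ) * (n : ℝ) ^ (-(2 : ℝ) / ((k : ℝ) - 1)) ≤ ((n.choose 2 : ℕ) : ℝ) / 8 := by
    have := mul_le_mul_of_nonneg_left hn8.le (Nat.cast_nonneg (n.choose 2) : (0 : ℝ) ≤ _)
    linarith
  have hm16 : (16 : ℝ) ≤ (thr k n : ℝ) := by linarith
  have h34 := rpow_three_quarters_le_half hm16
  have hj' : |(j : ℝ) - (thr k n : ℝ)| ≤ (thr k n : ℝ) ^ ((3 : ℝ) / 4) := hj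
  obtain ⟨hj1, hj2⟩ := abs_sub_le_iff.1 hj'
  have hjlo : (thr k n : ℝ) / 2 ≤ j := by linarith
  have hjhi : (j : ℝ) ≤ 3 * (thr k n : ℝ) / 2 := by linarith
  refine ⟨?_, ?_, ?_⟩
  · have h' : ((4 * j₀ + 3 : ℕ) : ℝ) ≤ n := by exact_mod_cast hnj₀
    push_cast at h'
    have : (j₀ : ℝ) ≤ j := by linarith
    exact_mod_cast this
  · have : (n : ℝ) ≤ 5 * j := by linarith
    exact_mod_cast this
  · have : (4 * j : ℝ) ≤ ((n.choose 2 : ℕ) : ℝ) := by linarith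
    exact_mod_cast this

/-! ### The kernel-checked composition -/

/-- **Composition of the side rung.** The four stub statements imply `ShallowSliceConc`. Parameters: `c₂ = 2c+5`
(binarised size exponent), `k = 4c₂ + 5`, `η = 1/4`; `θ = min θ₀ (1/2)`; the charge is invoked at `(d, 2c, θ/2)`;
`δ = min δ_F (1/8)`. No `sorry`. -/
theorem ShallowSliceConc_of (hB : Registered.stub_binarise) (hF : Registered.stub_forcingUp)
    (hQ : Registered.stub_cliqueScarcity) (hS : Registered.stub_shallowNotSharp) : ShallowSliceConc := by
  intro d c
  -- parameters
  set c₂ : ℕ := 2 * c + 5 with hc₂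
  set k : ℕ := 4 * c₂ + 5 with hkdef
  have hk5 : 5 ≤ k := by omega
  have hk3 : 3 ≤ k := by omega
  have h4c : 4 * c₂ < k := by omega
  obtain ⟨θ₀, hθ₀, δF, hδF, hFev⟩ := hF k hk5 c₂ h4c (1 / 4) (by norm_num)
  set θ : ℝ := min θ₀ (1 / 2) with hθdef
  have hθ0 : 0 < θ := lt_min hθ₀ (by norm_num)
  have hθ1 : θ ≤ 1 := (min_le_right _ _).trans (by norm_num)
  have hθθ₀ : θ ≤ θ₀ := min_le_left _ _
  obtain ⟨j₀, hSj₀⟩ := hS d (2 * c) (θ / 2) (half_pos hθ0)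
  -- `2 ≤ j^{θ/2}` for large `j`
  have hJev : ∀ᶠ j : ℕ in atTop, 2 ≤ (j : ℝ) ^ (θ / 2) :=
    ((tendsto_rpow_atTop (half_pos hθ0)).comp tendsto_natCast_atTop_atTop).eventually_ge_atTop 2
  obtain ⟨J, hJ⟩ := eventually_atTop.1 hJev
  -- factorial bound `2/k! ≤ 1/60`
  have hfac : (2 : ℝ) / (k.factorial : ℝ) ≤ 1 / 60 := by
    have h120 : (120 : ℝ) ≤ (k.factorial : ℝ) := by
      have : Nat.factorial 5 ≤ k.factorial := Nat.factorial_le hk5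
      have h5 : Nat.factorial 5 = 120 := by decide
      rw [h5] at this
      exact_mod_cast this
    rw [div_le_div_iff₀ (by linarith) (by norm_num)]
    linarith
  refine ⟨k, hk3, min δF (1 / 8), lt_min hδF (by norm_num), ?_⟩
  filter_upwards [hFev, hQ k hk5, window_eventually hk3 (max (max J j₀) 5), eventually_ge_atTop 2] with n hFn hQn
    hWn hn2 j hj D hD hdep herr
  obtain ⟨hjJ, hn5j, h4j⟩ := hWn j hj
  have hjJ' : J ≤ j := ((le_max_left _ _).trans (le_max_left _ _)).trans hjJ
  have hjj₀ : j₀ ≤ j := ((le_max_right _ _).trans (le_max_left _ _)).trans hjJ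
  have hj5 : 5 ≤ j := (le_max_right _ _).trans hjJ
  have hj1 : (1 : ℝ) ≤ j := by exact_mod_cast (show 1 ≤ j by omega)
  have hjpos : (0 : ℝ) < j := by linarith
  by_contra hbig
  have hsD : D.size ≤ n ^ c := not_lt.1 hbig
  -- binarise
  obtain ⟨C, hC01, hCeval, hCsize⟩ := hB (Edge n) D hD
  have hCsz : C.size ≤ n ^ c₂ := by
    rw [card_edge] at hCsize
    exact hCsize.trans (binSize_le hn2 hsD)
  -- error bounds for `C` (same function as `D`)
  have hsc0 : (0 : ℝ) ≤ (sliceCard n j : ℝ) := Nat.cast_nonneg _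
  have herrF : (errCount n k j C.eval : ℝ) ≤ δF * sliceCard n j := by
    rw [hCeval]
    exact herr.trans (mul_le_mul_of_nonneg_right (min_le_left _ _) hsc0)
  have herr8 : (errCount n k j D.eval : ℝ) ≤ 1 / 8 * sliceCard n j :=
    herr.trans (mul_le_mul_of_nonneg_right (min_le_right _ _) hsc0)
  -- the upper slice `t`
  obtain ⟨hwin1, hwin2⟩ := window_arith hθ0 hθ1 hj1 (hJ j hjJ')
  set t : ℕ := ⌈(j : ℝ) + (j : ℝ) ^ (1 - θ)⌉₊ with htdef
  have hrp0 : 0 ≤ (j : ℝ) ^ (1 - θ) := Real.rpow_nonneg hjpos.le _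
  have ht_ge : (j : ℝ) + (j : ℝ) ^ (1 - θ) ≤ t := Nat.le_ceil _
  have ht_lt : (t : ℝ) < (j : ℝ) + (j : ℝ) ^ (1 - θ) + 1 := Nat.ceil_lt_add_one (by positivity)
  have ht2j : t ≤ 2 * j := by
    have : (t : ℝ) ≤ 2 * j := by linarith
    exact_mod_cast this
  have htN : t ≤ n.choose 2 := by omega
  have hjt : j ≤ t := by
    have : (j : ℝ) ≤ t := by linarith
    exact_mod_cast this
  have ht_hi : (t : ℝ) ≤ j + (j : ℝ) ^ (1 - θ / 2) := by linarith
  have h2t : 2 * t ≤ Fintype.card (Edge n) := by rw [card_edge]; omega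
  -- forcing: `a_t(C) ≥ 3/4`
  have hF_win : (j : ℝ) + (j : ℝ) ^ (1 - θ₀) ≤ t := by
    have : (j : ℝ) ^ (1 - θ₀) ≤ (j : ℝ) ^ (1 - θ) :=
      Real.rpow_le_rpow_of_exponent_le hj1 (by linarith)
    linarith
  have hAt := hFn j hj C hC01 hCsz herrF t hF_win htN
  rw [hCeval] at hAt
  -- scarcity + accuracy: `a_j(D) ≤ 1/60 + 1/8`
  have hQj := hQn j hj
  have hAj : (accCount n j D.eval : ℝ) ≤ (1 / 60 + 1 / 8) * sliceCard n j := by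
    have h1 : (accCount n j D.eval : ℝ) ≤ accCount n j (cliqueFn n k) + errCount n k j D.eval := by
      exact_mod_cast accCount_le_clique_add_err k j D.eval
    have h2 : (2 : ℝ) / (k.factorial : ℝ) * sliceCard n j ≤ 1 / 60 * sliceCard n j :=
      mul_le_mul_of_nonneg_right hfac hsc0
    linarith
  -- the charge: `|a_t(D) − a_j(D)| ≤ 1/4`
  have hsizeD : D.size ≤ j ^ (2 * c) := by
    have h1 : n ^ c ≤ (5 * j) ^ c := Nat.pow_le_pow_left hn5j c
    have h2 : (5 * j) ^ c ≤ (j * j) ^ c := Nat.pow_le_pow_left (Nat.mul_le_mul_right j hj5) c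
    have h3 : (j * j) ^ c = j ^ (2 * c) := by rw [← pow_two, ← pow_mul]
    omega
  have hSres := hSj₀ (Edge n) j t hjj₀ hjt ht_hi h2t D (hD.mono monotoneACBasis_subset_acBasis) hdep hsizeD
  rw [sliceAvg_edge, sliceAvg_edge] at hSres
  have hdiff := (abs_le.1 hSres).2
  -- contradiction
  have hpost : (0 : ℝ) < (sliceCard n t : ℝ) := by exact_mod_cast sliceCard_pos htN
  have hposj : (0 : ℝ) < (sliceCard n j : ℝ) := by exact_mod_cast sliceCard_pos (by omega)
  have hat : (3 : ℝ) / 4 ≤ (accCount n t D.eval : ℝ) / (sliceCard n t : ℝ) := by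
    rw [le_div_iff₀ hpost]; linarith
  have haj : (accCount n j D.eval : ℝ) / (sliceCard n j : ℝ) ≤ 1 / 60 + 1 / 8 := by
    rw [div_le_iff₀ hposj]; linarith
  linarith

/-- The same composition fed with the registered stubs (an `example`, so that `ShallowSliceConc_of` stays the unique
theorem concluding the side rung). -/
example : ShallowSliceConc :=
  ShallowSliceConc_of stub_binarise stub_forcingUp stub_cliqueScarcity stub_shallowNotSharp

end Summit.PneNP.PneNP.Cruxes.ConstantBand.SharpnessSandwich

end
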